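import Mathlib
import HarnessLib
import Summits.HubbardSuperconductivity.HubbardSuperconductivity.Theorems.KLProgrammeKLRegimeEnginePairLadderTangentDuhamel
import Summits.HubbardSuperconductivity.HubbardSuperconductivity.Theorems.KLProgrammeKLRegimeEnginePairLadderBSDefect

/-!
# Route `KLProgramme` — crux K3, ENGINE child gen 8 (stmt-HubbardSuperconductivity-20437 `KLRegimeEngineV17F2`), stub (c) `stub_engine_step_values`,
# skeleton v2 class #5 «pair transfer»: the RELATIVE FLOW door — two Riccati flows compared through a relative weight, `kltc_relative_flow_duhamel`

Cell gate-hubbard-kl, seat hubbard-kl-k3c1-p1 (g10), technique «composed-map remainder propagation».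

WHY (CLASS5-DEFECT-BUDGET, evidence on 20437, 2026-08-27).  The pinned class-#5 step (`PairTransferStep2`, `…EngineV8PairTransferExport2`) cannot be produced by
COMPOSITION through the resummation square: every `kltc_*compose*` door returns a residue `≥ R′ + E` (history residue + plain-step residue at the same labels), the
history only supplies `R′ = transferBarAt (n−1)`, and `transferBarAt` is GAINED (summable in `n`), so `2·transferBarAt (n−1) ≤ transferBarAt n` would be needed and
fails at the Cooper labels above the thermal layer.  At value level the two inherited residues cancel (the slice-line structures of the history member and of
the plain step are the same object); what truly remains carries a line of the member's OWN soft covariance and is gained by its soft mass.  The closable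
organisation therefore never re-bases on the plain array inside the step: it compares the TWO MEMBERS' flows directly («relative family»), and the one door it
needs is this file.

THE RELATIVE OBJECT.  Two pair-ladder Riccati flows on `[0,1]` with sources, `Ȧ₁ = −A₁·diag ḃ₁·A₁ + S₁`, `Ȧ₂ = −A₂·diag ḃ₂·A₂ + S₂` (the Wick flows of two members
along one slice), and a relative weight `a(t)` with `ȧ = ḃ₁ − ḃ₂` (cumulative: `a(1) = a(0) + (b₁(1)−b₁(0)) − (b₂(1)−b₂(0))`).  The INVERSE-FREE relative residue
      `Ẽ(t) := A₁(t)·(1 + diag a(t)·A₂(t)) − A₂(t) = A₁ + A₁·diag a·A₂ − A₂`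
satisfies EXACTLY (`kltc_relative_flow_identity`, `noncomm_ring`)
      `dẼ/dt = −(A₁·diag ḃ₁·Ẽ + Ẽ·diag ḃ₂·A₂) + X_rel`,   `X_rel := S₁·(1 + diag a·A₂) + A₁·diag a·S₂ − S₂`
— the linearly dressed tangent flow of `…EnginePairLadderLinearDressing` / `…TangentDuhamel` with dressers `Γ₁ = A₁`, `Γ₂ = A₂` (the two flows themselves) and the
RELATIVE SOURCE `X_rel = (S₁ − S₂) + S₁·diag a·A₂ + A₁·diag a·S₂`: the difference of the two sources plus terms carrying the relative weight.  No inverse is ever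
differentiated.  At an endpoint where `1 + diag a·A₂` is inverted (`klcrs_single_slice`), `A₁ − A₂·N = Ẽ·N`: the forward relation `A₁ ≈ A₂·(1 + diag a·A₂)⁻¹` with
residue `Ẽ·N`, and conversely `Ẽ = (A₁ − A₂M)·(1 + diag a·A₂)` from a forward relation (`kltc_relResidue_le_of_fwd`, `kltc_fwd_of_relResidue`).

* §1 `kltc_relative_flow_identity` (exact), `kltc_relative_hasDerivAt` (entrywise derivative of `Ẽ`), continuity plumbing.
* §2 `kltc_linear_dressing_le_at`: the sup Gronwall a-priori bound of the dressed flow at EVERY `t ∈ [0,1]` (the `B` of `kltc_tangent_duhamel`; p541767 exported `t = 1`).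
* §3 **`kltc_relative_flow_duhamel`**: `kltc_tangent_duhamel` (p545005) applied to `Ẽ`, with the Bethe–Salpeter defects of the two flows DISCHARGED by
  `kltc_bsDefect_left_le` / `kltc_bsDefect_right_le` (p545892, `η_i = (8/3)ξ_i`, `ξ_i ≥ |S_i|`) and the a-priori bound by §2 (`B = δ·e^{2mβ} + 2ξ`, `ξ ≥ |X_rel|`):
  `‖Ẽ(1)(x,y)‖ ≤` four-term form of `S`, `S ≥ ‖Ẽ(0)‖ + FT_ρ(I) + (4/3)Bβ(η₁+η₂)`, `I(x,y) ≥ ∫₀¹‖X_rel(t)(x,y)‖dt` — the relative source enters through its WEIGHTED slice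
  integral (the currency the (E2) budgets consume via angular masses), nothing of the two flows' full-size sources is inherited except through `∫‖X_rel‖`.
* Sequel `…EnginePairLadderRelativeStep`: the endpoint conversions (forward relation ↔ relative residue) and the packaged step `kltc_relative_step_fwd`.  For class #5
  rev 3 (relative family, CLASS5-DEFECT-BUDGET §4): `A₂` = the flow of member `ψ₂`, `A₁` = of member `ψ₁`, `a` = the relative pinned weight, history residue
  `transferBarAt (n−1)·klSoftMass (n−1) (ψ₁−ψ₂)`, and the caller's analytic input per slice is `I ≤ (slice shapes)·klSoftMass n (ψ₁−ψ₂)` (every term of `X_rel`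
  carries a line of `S_{ψ₁−ψ₂}` or a factor `a`).

Real analysis + matrix algebra only; nothing about the model is asserted.  0 kit.
-/

noncomputable section

namespace Summit.HubbardSuperconductivity.HubbardSuperconductivity.Theorems.KLRegimeSplit

set_option linter.dupNamespace false -- summit = problem name (single-conjunct summit), D-0017

open Finset Matrix Set
open Summit.HubbardSuperconductivity.HubbardSuperconductivity.Theorems.KLProgrammeCooperResummation

/-! ## §1 The relative residue and its flow (exact algebra, entrywise calculus) -/

section Algebra

variable {ι : Type*} [Fintype ι] [DecidableEq ι]

/-- **The relative flow identity (exact).**  If `Ȧ₁ = −A₁D₁A₁ + S₁` and `Ȧ₂ = −A₂D₂A₂ + S₂`, then for any `D` (the relative weight) the derivative expression of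
`Ẽ = A₁ + A₁·D·A₂ − A₂` along `Ḋ = D₁ − D₂`, namely `Ȧ₁ + (Ȧ₁·D·A₂ + A₁·(D₁ − D₂)·A₂ + A₁·D·Ȧ₂) − Ȧ₂`, equals
`−(A₁·D₁·Ẽ + Ẽ·D₂·A₂) + (S₁·(1 + D·A₂) + A₁·D·S₂ − S₂)`. -/
theorem kltc_relative_flow_identity (A₁ A₁' A₂ A₂' S₁ S₂ D D₁ D₂ : Matrix ι ι ℂ)
    (h₁ : A₁' = -(A₁ * D₁ * A₁) + S₁) (h₂ : A₂' = -(A₂ * D₂ * A₂) + S₂) :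
    A₁' + (A₁' * D * A₂ + A₁ * (D₁ - D₂) * A₂ + A₁ * D * A₂') - A₂' =
      -(A₁ * D₁ * (A₁ + A₁ * D * A₂ - A₂) + (A₁ + A₁ * D * A₂ - A₂) * D₂ * A₂) +
        (S₁ * (1 + D * A₂) + A₁ * D * S₂ - S₂) := by
  rw [h₁, h₂]
  noncomm_ring

/-- At an endpoint: `A₁ + A₁·diag a·A₂ − A₂ = (A₁ − A₂·M)·(1 + diag a·A₂)` for a LEFT inverse `M` of `1 + diag a·A₂`. -/
theorem kltc_relResidue_eq_of_leftInv (A₁ A₂ M : Matrix ι ι ℂ) (a : ι → ℂ) (hM : M * (1 + diagonal a * A₂) = 1) :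
    A₁ + A₁ * diagonal a * A₂ - A₂ = (A₁ - A₂ * M) * (1 + diagonal a * A₂) := by
  have h : A₂ * M * (1 + diagonal a * A₂) = A₂ := by rw [mul_assoc, hM, mul_one]
  rw [sub_mul, h]
  noncomm_ring

/-- At an endpoint: `(A₁ + A₁·diag a·A₂ − A₂)·N = A₁ − A₂·N` for a RIGHT inverse `N` of `1 + diag a·A₂`. -/
theorem kltc_relResidue_mul_rightInv (A₁ A₂ N : Matrix ι ι ℂ) (a : ι → ℂ) (hN : (1 + diagonal a * A₂) * N = 1) :
    (A₁ + A₁ * diagonal a * A₂ - A₂) * N = A₁ - A₂ * N := by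
  have h : A₁ * (1 + diagonal a * A₂) * N = A₁ := by rw [mul_assoc, hN, mul_one]
  have e : A₁ + A₁ * diagonal a * A₂ - A₂ = A₁ * (1 + diagonal a * A₂) - A₂ := by noncomm_ring
  rw [e, sub_mul, h]

/-- Entries of the relative residue: `(A₁ + A₁·diag a·A₂ − A₂)(x,y) = A₁(x,y) + Σ_c A₁(x,c)·a_c·A₂(c,y) − A₂(x,y)`. -/
theorem kltc_relResidue_apply (A₁ A₂ : Matrix ι ι ℂ) (a : ι → ℂ) (x y : ι) :
    (A₁ + A₁ * diagonal a * A₂ - A₂) x y = A₁ x y + ∑ c, A₁ x c * a c * A₂ c y - A₂ x y := by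
  rw [Matrix.sub_apply, Matrix.add_apply, klli_mul_diag_mul_apply]

/-- **Entrywise derivative of the relative residue** along curves `A₁(t)`, `A₂(t)`, `a(t)` (product rule; no inverse is differentiated). -/
theorem kltc_relative_hasDerivAt (A₁ A₁' A₂ A₂' : ℝ → Matrix ι ι ℂ) (a a' : ℝ → ι → ℂ) {t : ℝ}
    (hA₁ : ∀ x y, HasDerivAt (fun s => A₁ s x y) (A₁' t x y) t) (hA₂ : ∀ x y, HasDerivAt (fun s => A₂ s x y) (A₂' t x y) t)
    (ha : ∀ c, HasDerivAt (fun s => a s c) (a' t c) t) (x y : ι) :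
    HasDerivAt (fun s => (A₁ s + A₁ s * diagonal (a s) * A₂ s - A₂ s) x y)
      ((A₁' t + (A₁' t * diagonal (a t) * A₂ t + A₁ t * diagonal (a' t) * A₂ t + A₁ t * diagonal (a t) * A₂' t) - A₂' t) x y) t := by
  have hfun : (fun s => (A₁ s + A₁ s * diagonal (a s) * A₂ s - A₂ s) x y) =
      fun s => A₁ s x y + ∑ c, A₁ s x c * a s c * A₂ s c y - A₂ s x y := by
    funext s; exact kltc_relResidue_apply (A₁ s) (A₂ s) (a s) x y
  have hval : ((A₁' t + (A₁' t * diagonal (a t) * A₂ t + A₁ t * diagonal (a' t) * A₂ t + A₁ t * diagonal (a t) * A₂' t) - A₂' t) x y) =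
      A₁' t x y + ∑ c, (A₁' t x c * a t c * A₂ t c y + A₁ t x c * a' t c * A₂ t c y + A₁ t x c * a t c * A₂' t c y) - A₂' t x y := by
    rw [Matrix.sub_apply, Matrix.add_apply, Matrix.add_apply, Matrix.add_apply, klli_mul_diag_mul_apply, klli_mul_diag_mul_apply,
      klli_mul_diag_mul_apply, ← sum_add_distrib, ← sum_add_distrib]
  rw [hfun, hval]
  refine ((hA₁ x y).add (HasDerivAt.fun_sum (u := (Finset.univ : Finset ι)) fun c _ => ?_)).sub (hA₂ x y)
  have h := ((hA₁ x c).mul (ha c)).mul (hA₂ c y)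
  refine h.congr_deriv ?_
  simp only [Pi.mul_apply]
  ring

omit [Fintype ι] [DecidableEq ι] in
/-- Entries of a difference of entrywise-continuous matrix curves are continuous. -/
theorem kltc_continuousOn_sub_apply {s : Set ℝ} {A B : ℝ → Matrix ι ι ℂ} (hA : ∀ x y, ContinuousOn (fun t => A t x y) s)
    (hB : ∀ x y, ContinuousOn (fun t => B t x y) s) (x y : ι) : ContinuousOn (fun t => (A t - B t) x y) s := by
  have h : ∀ t, (A t - B t) x y = A t x y - B t x y := fun t => rfl
  simp_rw [h]
  exact (hA x y).sub (hB x y)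

omit [Fintype ι] [DecidableEq ι] in
/-- Entries of the negative of an entrywise-continuous matrix curve are continuous. -/
theorem kltc_continuousOn_neg_apply {s : Set ℝ} {A : ℝ → Matrix ι ι ℂ} (hA : ∀ x y, ContinuousOn (fun t => A t x y) s) (x y : ι) :
    ContinuousOn (fun t => (-A t) x y) s := by
  have h : ∀ t, (-A t) x y = -(A t x y) := fun t => rfl
  simp_rw [h]
  exact (hA x y).neg

omit [Fintype ι] [DecidableEq ι] in
/-- Entries of a constant matrix curve are continuous. -/
theorem kltc_continuousOn_const_apply {s : Set ℝ} (C : Matrix ι ι ℂ) (x y : ι) : ContinuousOn (fun _ : ℝ => C x y) s :=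
  continuousOn_const

end Algebra

/-! ## §2 The a-priori bound of the linearly dressed flow at every time -/

section Apriori

variable {ι : Type*} [Fintype ι] [DecidableEq ι]

set_option maxHeartbeats 400000 in -- entrywise-derivative bookkeeping + Gronwall, as in `kltc_linear_dressing_gronwall`
/-- **Sup Gronwall at every time** for `Ė = −(Γ₁·diag ḃ₁·E + E·diag ḃ₂·Γ₂) + X` on `[0,1]`: `|Γ_i| ≤ m_i`, `Σ‖ḃ_i‖ ≤ β_i`, `|E(0)| ≤ δ`, `|X| ≤ ξ`,
`m₁β₁ + m₂β₂ ≤ 1` ⇒ `‖E(t)(x,y)‖ ≤ δ·exp(m₁β₁ + m₂β₂) + 2ξ` for every `t ∈ [0,1]` (the `B` input of `kltc_tangent_duhamel`). -/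
theorem kltc_linear_dressing_le_at (E E' X Γ₁ Γ₂ : ℝ → Matrix ι ι ℂ) (b₁' b₂' : ℝ → ι → ℂ) {m₁ m₂ β₁ β₂ δ ξ : ℝ}
    (hm₁ : 0 ≤ m₁) (hm₂ : 0 ≤ m₂) (hδ : 0 ≤ δ) (hξ : 0 ≤ ξ)
    (hE : ∀ t ∈ Icc (0 : ℝ) 1, ∀ x y, HasDerivAt (fun s => E s x y) (E' t x y) t)
    (hflow : ∀ t ∈ Icc (0 : ℝ) 1, E' t = -(Γ₁ t * diagonal (b₁' t) * E t + E t * diagonal (b₂' t) * Γ₂ t) + X t)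
    (hΓ₁ : ∀ t ∈ Icc (0 : ℝ) 1, ∀ x y, ‖Γ₁ t x y‖ ≤ m₁) (hΓ₂ : ∀ t ∈ Icc (0 : ℝ) 1, ∀ x y, ‖Γ₂ t x y‖ ≤ m₂)
    (hβ₁ : ∀ t ∈ Icc (0 : ℝ) 1, ∑ a, ‖b₁' t a‖ ≤ β₁) (hβ₂ : ∀ t ∈ Icc (0 : ℝ) 1, ∑ a, ‖b₂' t a‖ ≤ β₂)
    (hE0 : ∀ x y, ‖E 0 x y‖ ≤ δ) (hX : ∀ t ∈ Icc (0 : ℝ) 1, ∀ x y, ‖X t x y‖ ≤ ξ) (hK : m₁ * β₁ + m₂ * β₂ ≤ 1)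
    (t : ℝ) (ht : t ∈ Icc (0 : ℝ) 1) (x y : ι) :
    ‖E t x y‖ ≤ δ * Real.exp (m₁ * β₁ + m₂ * β₂) + 2 * ξ := by
  have h01 : (0 : ℝ) ∈ Icc (0 : ℝ) 1 := ⟨le_rfl, zero_le_one⟩
  have hβ₁0 : 0 ≤ β₁ := (sum_nonneg fun a _ => norm_nonneg _).trans (hβ₁ 0 h01)
  have hβ₂0 : 0 ≤ β₂ := (sum_nonneg fun a _ => norm_nonneg _).trans (hβ₂ 0 h01)
  -- the Pi-valued curve
  set f : ℝ → (ι × ι → ℂ) := fun t p => E t p.1 p.2 with hf_def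
  set f' : ℝ → (ι × ι → ℂ) := fun t p => E' t p.1 p.2 with hf'_def
  have hfderiv : ∀ t ∈ Icc (0 : ℝ) 1, HasDerivAt f (f' t) t := by
    intro t ht
    rw [hasDerivAt_pi]
    intro p
    exact hE t ht p.1 p.2
  have hfcont : ContinuousOn f (Icc (0 : ℝ) 1) := fun t ht => (hfderiv t ht).continuousAt.continuousWithinAt
  have hf0 : ‖f 0‖ ≤ δ := by
    rw [pi_norm_le_iff_of_nonneg hδ]
    rintro ⟨a, c⟩
    exact hE0 a c
  -- the differential inequality
  have hbound : ∀ t ∈ Ico (0 : ℝ) 1, ‖f' t‖ ≤ (m₁ * β₁ + m₂ * β₂) * ‖f t‖ + ξ := by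
    intro t ht
    have ht' : t ∈ Icc (0 : ℝ) 1 := Ico_subset_Icc_self ht
    have hnn : 0 ≤ (m₁ * β₁ + m₂ * β₂) * ‖f t‖ + ξ := by positivity
    rw [pi_norm_le_iff_of_nonneg hnn]
    rintro ⟨a, c⟩
    show ‖E' t a c‖ ≤ (m₁ * β₁ + m₂ * β₂) * ‖f t‖ + ξ
    rw [hflow t ht', Matrix.add_apply, Matrix.neg_apply, Matrix.add_apply]
    have hfe : ∀ u v, ‖E t u v‖ ≤ ‖f t‖ := fun u v => norm_le_pi_norm (f t) (u, v)
    have h1 : ‖(Γ₁ t * diagonal (b₁' t) * E t) a c‖ ≤ m₁ * β₁ * ‖f t‖ := by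
      rw [klli_mul_diag_mul_apply]
      calc ‖∑ d, Γ₁ t a d * b₁' t d * E t d c‖ ≤ ∑ d, ‖Γ₁ t a d * b₁' t d * E t d c‖ := norm_sum_le _ _
        _ ≤ ∑ d, m₁ * ‖b₁' t d‖ * ‖f t‖ := by
            refine sum_le_sum fun d _ => ?_
            rw [norm_mul, norm_mul]
            exact mul_le_mul (mul_le_mul_of_nonneg_right (hΓ₁ t ht' a d) (norm_nonneg _)) (hfe d c) (norm_nonneg _)
              (mul_nonneg hm₁ (norm_nonneg _))
        _ = m₁ * (∑ d, ‖b₁' t d‖) * ‖f t‖ := by rw [mul_sum, sum_mul]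
        _ ≤ m₁ * β₁ * ‖f t‖ := mul_le_mul_of_nonneg_right (mul_le_mul_of_nonneg_left (hβ₁ t ht') hm₁) (norm_nonneg _)
    have h2 : ‖(E t * diagonal (b₂' t) * Γ₂ t) a c‖ ≤ m₂ * β₂ * ‖f t‖ := by
      rw [klli_mul_diag_mul_apply]
      calc ‖∑ d, E t a d * b₂' t d * Γ₂ t d c‖ ≤ ∑ d, ‖E t a d * b₂' t d * Γ₂ t d c‖ := norm_sum_le _ _
        _ ≤ ∑ d, ‖f t‖ * ‖b₂' t d‖ * m₂ := by
            refine sum_le_sum fun d _ => ?_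
            rw [norm_mul, norm_mul]
            exact mul_le_mul (mul_le_mul_of_nonneg_right (hfe a d) (norm_nonneg _)) (hΓ₂ t ht' d c) (norm_nonneg _)
              (mul_nonneg (norm_nonneg _) (norm_nonneg _))
        _ = ‖f t‖ * (∑ d, ‖b₂' t d‖) * m₂ := by rw [mul_sum, sum_mul]
        _ ≤ ‖f t‖ * β₂ * m₂ :=
            mul_le_mul_of_nonneg_right (mul_le_mul_of_nonneg_left (hβ₂ t ht') (norm_nonneg _)) hm₂
        _ = m₂ * β₂ * ‖f t‖ := by ring
    calc ‖-((Γ₁ t * diagonal (b₁' t) * E t) a c + (E t * diagonal (b₂' t) * Γ₂ t) a c) + X t a c‖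
        ≤ ‖-((Γ₁ t * diagonal (b₁' t) * E t) a c + (E t * diagonal (b₂' t) * Γ₂ t) a c)‖ + ‖X t a c‖ := norm_add_le _ _
      _ ≤ (‖(Γ₁ t * diagonal (b₁' t) * E t) a c‖ + ‖(E t * diagonal (b₂' t) * Γ₂ t) a c‖) + ‖X t a c‖ := by
          rw [norm_neg]; exact add_le_add (norm_add_le _ _) le_rfl
      _ ≤ (m₁ * β₁ * ‖f t‖ + m₂ * β₂ * ‖f t‖) + ξ := add_le_add (add_le_add h1 h2) (hX t ht' a c)
      _ = (m₁ * β₁ + m₂ * β₂) * ‖f t‖ + ξ := by ring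
  -- Gronwall at time `t`, then monotonicity in time
  have hgron := norm_le_gronwallBound_of_norm_deriv_right_le (a := 0) (b := 1) hfcont
    (fun s hs => (hfderiv s (Ico_subset_Icc_self hs)).hasDerivWithinAt) hf0 hbound t ht
  rw [sub_zero] at hgron
  have hK0 : 0 ≤ m₁ * β₁ + m₂ * β₂ := by positivity
  have hmono := gronwallBound_mono (δ := δ) (K := m₁ * β₁ + m₂ * β₂) (ε := ξ) hδ hξ hK0 ht.2
  have h1 : gronwallBound δ (m₁ * β₁ + m₂ * β₂) ξ 1 ≤ δ * Real.exp (m₁ * β₁ + m₂ * β₂) + 2 * ξ := by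
    rw [kltc_gronwallBound_split, mul_one]
    exact add_le_add le_rfl (kllf_gronwall_const hK0 hK hξ)
  exact (norm_le_pi_norm (f t) (x, y)).trans ((hgron.trans hmono).trans h1)

end Apriori

/-! ## §3 The relative flow Duhamel bound -/

section RelativeDuhamel

variable {ι : Type*} [Fintype ι] [DecidableEq ι] [Nonempty ι]

set_option maxHeartbeats 800000 in -- long hypothesis list; the proof is plumbing into `kltc_tangent_duhamel`
/-- **Relative flow Duhamel (the class-#5 rev-3 step door).**  On `[0,1]`: two Riccati flows with sources `Ȧ_i = −A_i·diag ḃ_i·A_i + S_i` (entrywise C¹,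
`ḃ_i`, `S_i` entrywise continuous), `|A_i| ≤ m`, rates `Σ‖ḃ_i‖ ≤ β` with `mβ ≤ 1/3`, accumulated profiles `‖b_i(t) − b_i(0)‖ ≤ ρ_i` with `m·Σρ_i ≤ 1/3`, source sups
`|S_i| ≤ ξ_i`; a relative weight `a(t)` with `ȧ = ḃ₁ − ḃ₂`; for the relative residue `Ẽ(t) = A₁ + A₁·diag a·A₂ − A₂` and the relative source
`X_rel(t) = S₁·(1 + diag a·A₂) + A₁·diag a·S₂ − S₂`: `|Ẽ(0)| ≤ δ`, `|X_rel| ≤ ξ` (sups) and a weighted slice-integral majorant `I(x,y) ≥ ∫₀¹‖X_rel(t)(x,y)‖dt`.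
THEN with `B := δ·e^{mβ+mβ} + 2ξ`, `η_i := (8/3)ξ_i` and any
`S(x,y) ≥ ‖Ẽ(0)(x,y)‖ + [I(x,y) + Σ_{c} I(x,c)ρ₂(c)m + Σ_{a′} mρ₁(a′)I(a′,y) + ΣΣ mρ₁(a′)I(a′,c)ρ₂(c)m] + (4/3)·B·β·(η₁+η₂)`:
`‖Ẽ(1)(x,y)‖ ≤ S(x,y) + Σ_c S(x,c)ρ₂(c)(3m/2) + Σ_{a′} (3m/2)ρ₁(a′)S(a′,y) + ΣΣ (3m/2)ρ₁(a′)S(a′,c)ρ₂(c)(3m/2)`. -/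
theorem kltc_relative_flow_duhamel (A₁ A₁' A₂ A₂' S₁ S₂ : ℝ → Matrix ι ι ℂ) (b₁ b₂ b₁' b₂' a : ℝ → ι → ℂ) (ρ₁ ρ₂ : ι → ℝ)
    (I S : ι → ι → ℝ) {m β δ ξ ξ₁ ξ₂ : ℝ} (hm : 0 ≤ m) (hδ : 0 ≤ δ) (hξ : 0 ≤ ξ) (hξ₁ : 0 ≤ ξ₁) (hξ₂ : 0 ≤ ξ₂)
    (hA₁ : ∀ t ∈ Icc (0 : ℝ) 1, ∀ x y, HasDerivAt (fun s => A₁ s x y) (A₁' t x y) t)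
    (hA₂ : ∀ t ∈ Icc (0 : ℝ) 1, ∀ x y, HasDerivAt (fun s => A₂ s x y) (A₂' t x y) t)
    (hb₁ : ∀ t ∈ Icc (0 : ℝ) 1, ∀ c, HasDerivAt (fun s => b₁ s c) (b₁' t c) t)
    (hb₂ : ∀ t ∈ Icc (0 : ℝ) 1, ∀ c, HasDerivAt (fun s => b₂ s c) (b₂' t c) t)
    (ha : ∀ t ∈ Icc (0 : ℝ) 1, ∀ c, HasDerivAt (fun s => a s c) (b₁' t c - b₂' t c) t)
    (hb₁'c : ∀ c, ContinuousOn (fun t => b₁' t c) (Icc 0 1)) (hb₂'c : ∀ c, ContinuousOn (fun t => b₂' t c) (Icc 0 1))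
    (hS₁c : ∀ x y, ContinuousOn (fun t => S₁ t x y) (Icc 0 1)) (hS₂c : ∀ x y, ContinuousOn (fun t => S₂ t x y) (Icc 0 1))
    (hflow₁ : ∀ t ∈ Icc (0 : ℝ) 1, A₁' t = -(A₁ t * diagonal (b₁' t) * A₁ t) + S₁ t)
    (hflow₂ : ∀ t ∈ Icc (0 : ℝ) 1, A₂' t = -(A₂ t * diagonal (b₂' t) * A₂ t) + S₂ t)
    (hA₁m : ∀ t ∈ Icc (0 : ℝ) 1, ∀ x y, ‖A₁ t x y‖ ≤ m) (hA₂m : ∀ t ∈ Icc (0 : ℝ) 1, ∀ x y, ‖A₂ t x y‖ ≤ m)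
    (hβ₁ : ∀ t ∈ Icc (0 : ℝ) 1, ∑ c, ‖b₁' t c‖ ≤ β) (hβ₂ : ∀ t ∈ Icc (0 : ℝ) 1, ∑ c, ‖b₂' t c‖ ≤ β)
    (hρ₁ : ∀ t ∈ Icc (0 : ℝ) 1, ∀ c, ‖b₁ t c - b₁ 0 c‖ ≤ ρ₁ c) (hρ₂ : ∀ t ∈ Icc (0 : ℝ) 1, ∀ c, ‖b₂ t c - b₂ 0 c‖ ≤ ρ₂ c)
    (hmβ : m * β ≤ 1 / 3) (hZ₁ : m * ∑ c, ρ₁ c ≤ 1 / 3) (hZ₂ : m * ∑ c, ρ₂ c ≤ 1 / 3)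
    (hS₁ : ∀ t ∈ Icc (0 : ℝ) 1, ∀ x y, ‖S₁ t x y‖ ≤ ξ₁) (hS₂ : ∀ t ∈ Icc (0 : ℝ) 1, ∀ x y, ‖S₂ t x y‖ ≤ ξ₂)
    (hE0 : ∀ x y, ‖(A₁ 0 + A₁ 0 * diagonal (a 0) * A₂ 0 - A₂ 0) x y‖ ≤ δ)
    (hXξ : ∀ t ∈ Icc (0 : ℝ) 1, ∀ x y, ‖(S₁ t * (1 + diagonal (a t) * A₂ t) + A₁ t * diagonal (a t) * S₂ t - S₂ t) x y‖ ≤ ξ)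
    (hI : ∀ x y, (∫ t in (0 : ℝ)..1, ‖(S₁ t * (1 + diagonal (a t) * A₂ t) + A₁ t * diagonal (a t) * S₂ t - S₂ t) x y‖) ≤ I x y)
    (hS : ∀ x y, ‖(A₁ 0 + A₁ 0 * diagonal (a 0) * A₂ 0 - A₂ 0) x y‖ +
        (I x y + ∑ c, I x c * ρ₂ c * m + ∑ a', m * ρ₁ a' * I a' y + ∑ a', ∑ c, m * ρ₁ a' * I a' c * ρ₂ c * m) +
        4 / 3 * (δ * Real.exp (m * β + m * β) + 2 * ξ) * β * (8 / 3 * ξ₁ + 8 / 3 * ξ₂) ≤ S x y)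
    (x y : ι) :
    ‖(A₁ 1 + A₁ 1 * diagonal (a 1) * A₂ 1 - A₂ 1) x y‖ ≤
      S x y + ∑ c, S x c * ρ₂ c * (3 / 2 * m) + ∑ a', 3 / 2 * m * ρ₁ a' * S a' y +
        ∑ a', ∑ c, 3 / 2 * m * ρ₁ a' * S a' c * ρ₂ c * (3 / 2 * m) := by
  have h01 : (0 : ℝ) ∈ Icc (0 : ℝ) 1 := ⟨le_rfl, zero_le_one⟩
  have hβ0 : 0 ≤ β := (sum_nonneg fun c _ => norm_nonneg _).trans (hβ₁ 0 h01)
  -- the relative residue, its derivative and source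
  set E : ℝ → Matrix ι ι ℂ := fun t => A₁ t + A₁ t * diagonal (a t) * A₂ t - A₂ t with hE_def
  set a' : ℝ → ι → ℂ := fun t c => b₁' t c - b₂' t c with ha'_def
  set E' : ℝ → Matrix ι ι ℂ := fun t =>
    A₁' t + (A₁' t * diagonal (a t) * A₂ t + A₁ t * diagonal (a' t) * A₂ t + A₁ t * diagonal (a t) * A₂' t) - A₂' t with hE'_def
  set X : ℝ → Matrix ι ι ℂ := fun t => S₁ t * (1 + diagonal (a t) * A₂ t) + A₁ t * diagonal (a t) * S₂ t - S₂ t with hX_def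
  have hdiag : ∀ t, diagonal (a' t) = diagonal (b₁' t) - diagonal (b₂' t) := by
    intro t
    ext u v
    by_cases h : u = v
    · subst h; simp [ha'_def]
    · simp [Matrix.sub_apply, h]
  -- the dressed tangent equation (exact)
  have hflowE : ∀ t ∈ Icc (0 : ℝ) 1, E' t = -(A₁ t * diagonal (b₁' t) * E t + E t * diagonal (b₂' t) * A₂ t) + X t := by
    intro t ht
    simp only [hE'_def, hE_def, hX_def]
    rw [hdiag t]
    exact kltc_relative_flow_identity (A₁ t) (A₁' t) (A₂ t) (A₂' t) (S₁ t) (S₂ t) (diagonal (a t)) (diagonal (b₁' t)) (diagonal (b₂' t))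
      (hflow₁ t ht) (hflow₂ t ht)
  -- entrywise derivative of `E`
  have hEd : ∀ t ∈ Icc (0 : ℝ) 1, ∀ u v, HasDerivAt (fun s => E s u v) (E' t u v) t := fun t ht u v =>
    kltc_relative_hasDerivAt A₁ A₁' A₂ A₂' a a' (hA₁ t ht) (hA₂ t ht) (ha t ht) u v
  -- continuity of everything
  have hA₁c : ∀ u v, ContinuousOn (fun t => A₁ t u v) (Icc 0 1) := fun u v t ht => (hA₁ t ht u v).continuousAt.continuousWithinAt
  have hA₂c : ∀ u v, ContinuousOn (fun t => A₂ t u v) (Icc 0 1) := fun u v t ht => (hA₂ t ht u v).continuousAt.continuousWithinAt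
  have hac : ∀ c, ContinuousOn (fun t => a t c) (Icc 0 1) := fun c t ht => (ha t ht c).continuousAt.continuousWithinAt
  have ha'c : ∀ c, ContinuousOn (fun t => a' t c) (Icc 0 1) := fun c => (hb₁'c c).sub (hb₂'c c)
  have hDa : ∀ u v, ContinuousOn (fun t => diagonal (a t) u v) (Icc 0 1) := kltc_continuousOn_diagonal_apply hac
  have hDa' : ∀ u v, ContinuousOn (fun t => diagonal (a' t) u v) (Icc 0 1) := kltc_continuousOn_diagonal_apply ha'c
  have hD₁ : ∀ u v, ContinuousOn (fun t => diagonal (b₁' t) u v) (Icc 0 1) := kltc_continuousOn_diagonal_apply hb₁'c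
  have hD₂ : ∀ u v, ContinuousOn (fun t => diagonal (b₂' t) u v) (Icc 0 1) := kltc_continuousOn_diagonal_apply hb₂'c
  have hA₁'c : ∀ u v, ContinuousOn (fun t => A₁' t u v) (Icc 0 1) := by
    have h : ∀ u v, ContinuousOn (fun t => (-(A₁ t * diagonal (b₁' t) * A₁ t) + S₁ t) u v) (Icc 0 1) :=
      kltc_continuousOn_add_apply (kltc_continuousOn_neg_apply (kltc_continuousOn_mul_apply (kltc_continuousOn_mul_apply hA₁c hD₁) hA₁c)) hS₁c
    intro u v
    exact (h u v).congr fun t ht => by rw [hflow₁ t ht]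
  have hA₂'c : ∀ u v, ContinuousOn (fun t => A₂' t u v) (Icc 0 1) := by
    have h : ∀ u v, ContinuousOn (fun t => (-(A₂ t * diagonal (b₂' t) * A₂ t) + S₂ t) u v) (Icc 0 1) :=
      kltc_continuousOn_add_apply (kltc_continuousOn_neg_apply (kltc_continuousOn_mul_apply (kltc_continuousOn_mul_apply hA₂c hD₂) hA₂c)) hS₂c
    intro u v
    exact (h u v).congr fun t ht => by rw [hflow₂ t ht]
  have hE'c : ∀ u v, ContinuousOn (fun t => E' t u v) (Icc 0 1) := by
    simp only [hE'_def]
    exact kltc_continuousOn_sub_apply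
      (kltc_continuousOn_add_apply hA₁'c
        (kltc_continuousOn_add_apply
          (kltc_continuousOn_add_apply (kltc_continuousOn_mul_apply (kltc_continuousOn_mul_apply hA₁'c hDa) hA₂c)
            (kltc_continuousOn_mul_apply (kltc_continuousOn_mul_apply hA₁c hDa') hA₂c))
          (kltc_continuousOn_mul_apply (kltc_continuousOn_mul_apply hA₁c hDa) hA₂'c)))
      hA₂'c
  have hone : ∀ u v, ContinuousOn (fun _ : ℝ => (1 : Matrix ι ι ℂ) u v) (Icc 0 1) := fun u v => continuousOn_const
  have hXc : ∀ u v, ContinuousOn (fun t => X t u v) (Icc 0 1) := by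
    simp only [hX_def]
    exact kltc_continuousOn_sub_apply
      (kltc_continuousOn_add_apply
        (kltc_continuousOn_mul_apply hS₁c (kltc_continuousOn_add_apply hone (kltc_continuousOn_mul_apply hDa hA₂c)))
        (kltc_continuousOn_mul_apply (kltc_continuousOn_mul_apply hA₁c hDa) hS₂c))
      hS₂c
  -- a priori bound at every time
  have hK : m * β + m * β ≤ 1 := by linarith
  have hEB : ∀ t ∈ Icc (0 : ℝ) 1, ∀ u v, ‖E t u v‖ ≤ δ * Real.exp (m * β + m * β) + 2 * ξ :=
    kltc_linear_dressing_le_at E E' X A₁ A₂ b₁' b₂' hm hm hδ hξ hEd hflowE hA₁m hA₂m hβ₁ hβ₂ hE0 hXξ hK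
  have hB0 : 0 ≤ δ * Real.exp (m * β + m * β) + 2 * ξ := by positivity
  -- the Bethe–Salpeter defects of the two flows
  have hZ₁' : ∀ t ∈ Icc (0 : ℝ) 1, ∑ c, ‖b₁ t c - b₁ 0 c‖ ≤ ∑ c, ρ₁ c := fun t ht => sum_le_sum fun c _ => hρ₁ t ht c
  have hZ₂' : ∀ t ∈ Icc (0 : ℝ) 1, ∑ c, ‖b₂ t c - b₂ 0 c‖ ≤ ∑ c, ρ₂ c := fun t ht => sum_le_sum fun c _ => hρ₂ t ht c
  have hX₁ : ∀ t ∈ Icc (0 : ℝ) 1, ∀ u v, ‖A₁' t u v + (A₁ t * diagonal (b₁' t) * A₁ t) u v‖ ≤ ξ₁ := by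
    intro t ht u v
    have e : A₁' t u v + (A₁ t * diagonal (b₁' t) * A₁ t) u v = S₁ t u v := by
      rw [hflow₁ t ht, Matrix.add_apply, Matrix.neg_apply]; ring
    rw [e]; exact hS₁ t ht u v
  have hX₂ : ∀ t ∈ Icc (0 : ℝ) 1, ∀ u v, ‖A₂' t u v + (A₂ t * diagonal (b₂' t) * A₂ t) u v‖ ≤ ξ₂ := by
    intro t ht u v
    have e : A₂' t u v + (A₂ t * diagonal (b₂' t) * A₂ t) u v = S₂ t u v := by
      rw [hflow₂ t ht, Matrix.add_apply, Matrix.neg_apply]; ring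
    rw [e]; exact hS₂ t ht u v
  have hdef₁ : ∀ t ∈ Icc (0 : ℝ) 1, ∀ u v, ‖((1 + A₁ 0 * diagonal (fun c => b₁ t c - b₁ 0 c)) * A₁ t - A₁ 0) u v‖ ≤ 8 / 3 * ξ₁ :=
    fun t ht u v => kltc_bsDefect_left_le A₁ A₁' b₁ b₁' hm hξ₁ hA₁ hb₁ hA₁m hβ₁ hZ₁' hmβ hZ₁ hX₁ t ht u v
  have hdef₂ : ∀ t ∈ Icc (0 : ℝ) 1, ∀ u v, ‖(A₂ t * (1 + diagonal (fun c => b₂ t c - b₂ 0 c) * A₂ 0) - A₂ 0) u v‖ ≤ 8 / 3 * ξ₂ :=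
    fun t ht u v => kltc_bsDefect_right_le A₂ A₂' b₂ b₂' hm hξ₂ hA₂ hb₂ hA₂m hβ₂ hZ₂' hmβ hZ₂ hX₂ t ht u v
  -- the tangent Duhamel bound
  have h := kltc_tangent_duhamel E E' X A₁ A₂ b₁ b₂ b₁' b₂' ρ₁ ρ₂ I S hm hB0 (by positivity : (0 : ℝ) ≤ 8 / 3 * ξ₁)
    (by positivity : (0 : ℝ) ≤ 8 / 3 * ξ₂) hEd hE'c hb₁ hb₂ hb₁'c hb₂'c hXc hflowE hA₁m hA₂m hβ₁ hβ₂ hρ₁ hρ₂ hZ₁ hZ₂ hEB hdef₁ hdef₂ hI hS x y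
  simpa only [hE_def] using h

end RelativeDuhamel

end Summit.HubbardSuperconductivity.HubbardSuperconductivity.Theorems.KLRegimeSplit

end
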